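import Summits.BirchSwinnertonDyer.BirchSwinnertonDyer.Theorems.GoldfeldGoodTwistsAllTwistsCells
import HarnessLib

set_option linter.dupNamespace false -- namespace `…BirchSwinnertonDyer.BirchSwinnertonDyer…` is the cell's (D-0017 nested layout)
set_option autoImplicit false

/-!
# Route `GoldfeldAllTwistsTwoConverse`, crux K12₂′ `RankOneTwoConverseCMSevenAtAnyTwo` (item stmt-BirchSwinnertonDyer-19349),
# line `birth`: the registered stub `stub_modelReduction` BY NAME

The registered skeleton of crux K12₂′ (planner bsd-goldfeld-plan g5, `Cruxes/RankOneTwoConverseCMSevenAtAnyTwo/Lines/birth.lean`,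
sha16 `9e7b3962da790c1f`) has three stubs. The first, `stub_modelReduction` (STUB M, model + isogeny reduction: every elliptic
`W/ℚ` with `j(W) ∈ {−3375, 16581375}` and `corank_{ℤ₂} Sel_{2^∞}(W/ℚ) = 1` has a GLOBALLY MINIMAL companion `W'` with
`j(W') = −3375`, the same `2^∞`-Selmer corank and the same analytic rank), is VERBATIM the tree theorem
`Summit.BirchSwinnertonDyer.BirchSwinnertonDyer.Theorems.GoldfeldGoodTwists.modelReduction_rankOneTwoConverse`
(file `GoldfeldGoodTwistsAllTwistsCells`, §3: a globally minimal isogenous model with `j = −3375` exists by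
`exists_isGloballyMinimal_isIsogenous_j_eq_neg3375` — for `j = 16581375` the `2`-isogenous curve with CM by the maximal
order of `ℚ(√−7)` —, the `2^∞`-Selmer corank is an isogeny invariant (`IsIsogenous.selmerCorank_eq`, Greenberg LNM 1716 §1)
and so is the analytic rank (`analyticRank_eq_of_isIsogenous'`, Faltings: isogenous curves share their `L`-function)).
This file records the stub under its registered name, so that the skeleton's `sorry` at `stub_modelReduction` is
discharged by name.

HONEST FRAMING: closes ONE registered stub of line `birth` (pure bookkeeping, no new mathematics); the print stub
`stub_twoConverse_good` (= the `p = 2` slice of Burungale–Castella–Skinner–Tian 2022 Thm. A on the `j = −3375` class,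
Literature fact `BurungaleCastellaSkinnerTian2022.ThmA_at_two`, conditional closer
`GoldfeldGoodTwists.rankOneTwoConverse_goodCell_of_thmA_at_two`) and the research stub `stub_twoConverse_additive`
(= item 20044, K12₂″) stay open; crux K12₂′ (19349) is NOT closed; BSD is proved for no curve. No `sorry`, no definition.
-/

namespace Summit.BirchSwinnertonDyer.BirchSwinnertonDyer.Theorems.GoldfeldGoodTwists.K12Birth

/-- **Registered stub `stub_modelReduction` of line `birth` (crux K12₂′, item 19349)**: every elliptic `W/ℚ` with
`j(W) ∈ {−3375, 16581375}` and `corank_{ℤ₂} Sel_{2^∞}(W/ℚ) = 1` has a globally minimal companion `W'/ℚ` with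
`j(W') = −3375`, `corank_{ℤ₂} Sel_{2^∞}(W'/ℚ) = 1` and `ord_{s=1} L(W', s) = ord_{s=1} L(W, s)` — discharged by the tree
theorem `GoldfeldGoodTwists.modelReduction_rankOneTwoConverse` (minimal isogenous model with `j = −3375`; isogeny
invariance of the Selmer corank and of the analytic rank).
[cite: Greenberg1999LNM, §1 pp. 54–57] [cite: SilvermanAEC2009, VIII.8, Cor. 8.3] -/
theorem stub_modelReduction :
    ∀ (W : WeierstrassCurve ℚ) [W.IsElliptic], (W.j = -3375 ∨ W.j = 16581375) → W.selmerCorank 2 = 1 →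
      ∃ (W' : WeierstrassCurve ℚ) (_ : W'.IsElliptic) (_ : W'.IsGloballyMinimal),
        W'.j = -3375 ∧ W'.selmerCorank 2 = 1 ∧ W'.analyticRank = W.analyticRank :=
  fun W _ hj hsel => modelReduction_rankOneTwoConverse W hj hsel

end Summit.BirchSwinnertonDyer.BirchSwinnertonDyer.Theorems.GoldfeldGoodTwists.K12Birth
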